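import Mathlib
import HarnessLib
import Literature.MathematicalPhysics.StatisticalMechanics.InitialActivityHamiltonianNorm
import Literature.MathematicalPhysics.StatisticalMechanics.ActivityExtensionStep

/-!
# `ℋ ↦ K̂_0(𝒦, ℋ)` as the datum `y₀ : E_0 → F_0` of the fine-tuning engine: hypotheses `hy₀` and
# `hm` of `RGFlow.exists_isTunedQ_initial_eq` for the torus data ([ABKM19] Lemma 12.2 / Lemma 12.6)

Continuation of `InitialActivityHamiltonianNorm.lean`.  The fine-tuning engine
(`Literature.Dynamics.Hyperbolic.RGFlowStableManifoldReducedLipschitz`) takes the initial irrelevant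
coordinate as a map `y₀ : E 0 → F 0` from the Banach space of relevant Hamiltonians at scale `0`
(`HamSpace ℂ d 𝔥₀ L^0 L^0`) to the admissible activities (`activitySpace P 0`), with
`Q 0 (y₀ h) c₀` (`hy₀`) and `Q 0 (y₀ h − y₀ h') (m₀‖h − h'‖)` (`hm`).  Here:

* `mulExt_restrictConn_initKH` — `mulExt (restrictConn K̂_0) = K̂_0` (the restriction to connected
  polymers loses nothing, `K̂_0` factorises);
* `restrictConn_initKH_mem_activitySpace` — `K̂_0(𝒦, ℋ)` restricted to connected polymers is an
  admissible scale-`0` activity;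
* **`initAct 𝒦`** — `y₀(x) = restrictConn (K̂_0(𝒦, toHam x))` (or `0` when not admissible),
  `coe_initAct_of_mem`, **`activityNormLE_initAct`** (`hy₀` with `c₀ = e^{1/4}ρe^{𝔥₀}A`),
  **`activityNormLE_initAct_sub`** (`hm` with `m₀ = 16e^{3/8}ρe^{𝔥₀}A`), `mulExt_initAct`.

Everything is proved; no named fact.

## References
* S. Adams, S. Buchholz, R. Kotecký, S. Müller, arXiv:1910.13564, Ch. 12.1 (12.8), (12.11),
  Lemma 12.2, Lemma 12.6 [AdamsBuchholzKoteckyMuller2019].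
-/

noncomputable section

namespace Literature.MathematicalPhysics.StatisticalMechanics.GradientRG

open scoped BigOperators Classical
open Finset Matrix
open Literature.MathematicalPhysics.StatisticalMechanics.TorusPolymer
  (IsPolymer blocks bprod blockOf thicken numBlocks mem_blocks subset_thicken thicken_mono
    isPolymer_empty card_blocks_eq_numBlocks)
open Literature.Barriers.CriticalPhenomena.LongRangePhi4.Polymer (IsConn)
open Literature.MathematicalPhysics.StatisticalMechanics.GradientFRD (iterDiff)
open Literature.MathematicalPhysics.QuantumFieldTheory

variable {d M : ℕ} [NeZero M]
/-! ## `ℋ ↦ K̂_0(𝒦, ℋ)` as the datum `y₀` of the fine-tuning engine -/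

section Bundled

variable {L N Mord R n p r₀ : ℕ} {θbar lam μ δ₁ δ₀ A𝒫 h A : ℝ} {𝒞 : ℕ → (Fin d → ZMod M) → ℝ}

/-- `mulExt (restrictConn K̂_0(𝒦, ℋ)) = K̂_0(𝒦, ℋ)` on every set of sites (`L` odd, `M = L^N`): the
restriction to connected polymers loses nothing since `K̂_0` factorises.
[cite: AdamsBuchholzKoteckyMuller2019, Lemma 6.4 (5) (6.35) at k = 0] -/
theorem mulExt_restrictConn_initKH (hLodd : Odd L) (hM : M = L ^ N) (𝒦 : (Fin d → ℝ) → ℂ)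
    (H : RelevantHamiltonian ℂ d) (X : Finset (Fin d → ZMod M)) :
    mulExt (restrictConn (L ^ 0) (initKH 𝒦 H)) X = initKH 𝒦 H X :=
  mulExt_restrictConn_eq_of_factorises (s := L ^ 0) (t := L ^ N) (by rw [pow_zero, one_mul]; exact hM)
    hLodd.pow hLodd.pow (factorises_initKH 𝒦 H (L ^ 0)) (initKH_empty 𝒦 H)
    (by rw [pow_zero]; exact isPolymer_one X)

/-- **`K̂_0(𝒦, ℋ)` (restricted to connected polymers) is an admissible scale-`0` activity** under the
hypotheses of `weakNormLE_initKH`. [cite: AdamsBuchholzKoteckyMuller2019, Lemma 12.2] -/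
theorem restrictConn_initKH_mem_activitySpace (hd : 2 ≤ d) (hLodd : Odd L) (hM : M = L ^ N)
    (hp : d / 2 + 1 ≤ p) (hMord : d / 2 + 1 ≤ Mord)
    (hB : AbkmWeightBounds L N Mord R n θbar lam μ δ₁ δ₀ A𝒫 𝒞
      (abkmWeightData L N Mord R θbar (schedDelta δ₀ δ₁ N) 𝒞))
    (hδ₀ : 0 < δ₀) (hδ₁ : 0 < δ₁) (hh : 0 < h) (hh0 : hZeroSq d R δ₀ δ₁ ≤ h ^ 2) (hA : 0 < A)
    {𝒦 : (Fin d → ℝ) → ℂ} {ρ : ℝ} (h𝒦 : ContDiff ℝ r₀ 𝒦)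
    (h𝒦b : ∀ k, k ≤ r₀ → ∀ z : Fin d → ℝ, ‖iteratedFDeriv ℝ k 𝒦 z‖ ≤ ρ * Real.exp ((∑ i, z i ^ 2) / 4))
    {H : RelevantHamiltonian ℂ d}
    (hH : hamNorm (fieldWt h (L : ℝ) d 0) ((L : ℝ) ^ 0) (L ^ (d * 0)) H ≤ 1 / 8)
    (hsmall : Real.exp (1 / 4) * (ρ * Real.exp (fieldWt h (L : ℝ) d 0 / (L : ℝ) ^ 0)) * A ≤ 1) :
    restrictConn (L ^ 0) (initKH 𝒦 H) ∈
      activitySpace (abkmNormParams L N Mord R p r₀ h θbar A (schedDelta δ₀ δ₁ N) 𝒞) 0 := by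
  have hL0 : (0 : ℝ) < L := by exact_mod_cast hLodd.pos
  have h𝔥 : 0 < fieldWt h (L : ℝ) d 0 := fieldWt_pos hh hL0 d 0
  have hR0 : (0 : ℝ) < (L : ℝ) ^ 0 := by positivity
  have hMt : M = (abkmNormParams L N Mord R p r₀ h θbar A (schedDelta δ₀ δ₁ N) 𝒞).L ^ 0 * L ^ N := by
    rw [pow_zero, one_mul]; exact hM
  exact restrictConn_mem_activitySpace (k := 0) hMt hLodd.pow hLodd.pow
    (fun X _ _ => contDiff_initKH 𝒦 H h𝒦 X)
    (fun X _ _ => isGaugeLocal_initKH 𝒦 H h𝔥 hR0 hp (subset_thicken _ X))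
    (transInv_initKH 𝒦 H _)
    (weakNormLE_initKH hd hLodd hM hp hMord hB hδ₀ hδ₁ hh hh0 hA h𝒦 h𝒦b hH hsmall)

/-- **`y₀(ℋ) = K̂_0(𝒦, ℋ)`** as a map from the Banach space of relevant Hamiltonians at scale `0` to
the admissible scale-`0` activities (norms of the weight tower `abkmWeightData …`): the restriction of
`K̂_0(𝒦, toHam x)` to connected polymers when it is admissible, `0` otherwise — the datum `y₀` of
`RGFlow.exists_isTunedQ_initial_eq`. [cite: AdamsBuchholzKoteckyMuller2019, Ch. 12.1 (12.8), Lemma 12.6] -/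
def initAct {L N Mord R p r₀ : ℕ} {h θbar A δ₀ δ₁ : ℝ} {𝒞 : ℕ → (Fin d → ZMod M) → ℝ}
    (𝒦 : (Fin d → ℝ) → ℂ) (x : HamSpace ℂ d (fieldWt h (L : ℝ) d 0) ((L : ℝ) ^ 0) (L ^ (d * 0))) :
    activitySpace (abkmNormParams L N Mord R p r₀ h θbar A (schedDelta δ₀ δ₁ N) 𝒞) 0 :=
  if hmem : restrictConn (L ^ 0) (initKH 𝒦 (HamSpace.toHam x)) ∈
      activitySpace (abkmNormParams L N Mord R p r₀ h θbar A (schedDelta δ₀ δ₁ N) 𝒞) 0 then ⟨_, hmem⟩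
  else 0

/-- The value of `initAct` when admissible. [cite: AdamsBuchholzKoteckyMuller2019, Ch. 12.1 (12.8)] -/
theorem coe_initAct_of_mem {h δ₀ δ₁ : ℝ} {𝒦 : (Fin d → ℝ) → ℂ}
    {x : HamSpace ℂ d (fieldWt h (L : ℝ) d 0) ((L : ℝ) ^ 0) (L ^ (d * 0))}
    (hmem : restrictConn (L ^ 0) (initKH 𝒦 (HamSpace.toHam x)) ∈
      activitySpace (abkmNormParams L N Mord R p r₀ h θbar A (schedDelta δ₀ δ₁ N) 𝒞) 0) :
    ((initAct (N := N) (Mord := Mord) (R := R) (p := p) (r₀ := r₀) (θbar := θbar) (A := A) (δ₀ := δ₀)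
        (δ₁ := δ₁) (𝒞 := 𝒞) 𝒦 x :
        activitySpace (abkmNormParams L N Mord R p r₀ h θbar A (schedDelta δ₀ δ₁ N) 𝒞) 0) :
      Finset (Fin d → ZMod M) → ((Fin d → ZMod M) → ℝ) → ℂ) =
      restrictConn (L ^ 0) (initKH 𝒦 (HamSpace.toHam x)) := by
  unfold initAct
  rw [dif_pos hmem]

/-- **Hypothesis `hy₀` of `RGFlow.exists_isTunedQ_initial_eq` for the torus data**:
`‖y₀(ℋ)‖_0^{(A)} ≤ e^{1/4}ρe^{𝔥_0}A` for `‖ℋ‖ ≤ ⅛` (when `e^{1/4}ρe^{𝔥_0}A ≤ 1`).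
[cite: AdamsBuchholzKoteckyMuller2019, Lemma 12.2 (12.9) / Theorem 12.1 (12.34)] -/
theorem activityNormLE_initAct
    [∀ j : ℕ, Fact (0 < fieldWt h (L : ℝ) d j)] [∀ j : ℕ, Fact (0 < (L : ℝ) ^ j)] [∀ j : ℕ, Fact (0 < L ^ (d * j))]
    (hd : 2 ≤ d) (hLodd : Odd L) (hM : M = L ^ N)
    (hp : d / 2 + 1 ≤ p) (hMord : d / 2 + 1 ≤ Mord)
    (hB : AbkmWeightBounds L N Mord R n θbar lam μ δ₁ δ₀ A𝒫 𝒞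
      (abkmWeightData L N Mord R θbar (schedDelta δ₀ δ₁ N) 𝒞))
    (hδ₀ : 0 < δ₀) (hδ₁ : 0 < δ₁) (hh : 0 < h) (hh0 : hZeroSq d R δ₀ δ₁ ≤ h ^ 2) (hA : 0 < A)
    {𝒦 : (Fin d → ℝ) → ℂ} {ρ : ℝ} (h𝒦 : ContDiff ℝ r₀ 𝒦)
    (h𝒦b : ∀ k, k ≤ r₀ → ∀ z : Fin d → ℝ, ‖iteratedFDeriv ℝ k 𝒦 z‖ ≤ ρ * Real.exp ((∑ i, z i ^ 2) / 4))
    (hsmall : Real.exp (1 / 4) * (ρ * Real.exp (fieldWt h (L : ℝ) d 0 / (L : ℝ) ^ 0)) * A ≤ 1)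
    (x : HamSpace ℂ d (fieldWt h (L : ℝ) d 0) ((L : ℝ) ^ 0) (L ^ (d * 0))) (hx : ‖x‖ ≤ 1 / 8) :
    activityNormLE (abkmNormParams L N Mord R p r₀ h θbar A (schedDelta δ₀ δ₁ N) 𝒞) 0
      (initAct (N := N) (Mord := Mord) (R := R) (p := p) (r₀ := r₀) (θbar := θbar) (A := A) (δ₀ := δ₀)
        (δ₁ := δ₁) (𝒞 := 𝒞) 𝒦 x)
      (Real.exp (1 / 4) * (ρ * Real.exp (fieldWt h (L : ℝ) d 0 / (L : ℝ) ^ 0)) * A) := by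
  have hH : hamNorm (fieldWt h (L : ℝ) d 0) ((L : ℝ) ^ 0) (L ^ (d * 0)) (HamSpace.toHam x) ≤ 1 / 8 := by
    rwa [HamSpace.norm_def] at hx
  have hmem := restrictConn_initKH_mem_activitySpace hd hLodd hM hp hMord hB hδ₀ hδ₁ hh hh0 hA h𝒦 h𝒦b hH hsmall
  unfold activityNormLE
  rw [coe_initAct_of_mem hmem]
  exact weakNormLE_restrictConn_iff.2
    (weakNormLE_initKH hd hLodd hM hp hMord hB hδ₀ hδ₁ hh hh0 hA h𝒦 h𝒦b hH hsmall)

/-- **Hypothesis `hm` of `RGFlow.exists_isTunedQ_initial_eq` for the torus data**: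
`‖y₀(ℋ) − y₀(ℋ')‖_0^{(A)} ≤ 16e^{3/8}ρe^{𝔥_0}A · ‖ℋ − ℋ'‖` for `‖ℋ‖, ‖ℋ'‖ ≤ 1/16`
(when `(e^{1/4} + 2e^{3/8})ρe^{𝔥_0}A ≤ ½`). [cite: AdamsBuchholzKoteckyMuller2019, Lemma 12.2 (12.9) / Lemma 12.6] -/
theorem activityNormLE_initAct_sub
    [∀ j : ℕ, Fact (0 < fieldWt h (L : ℝ) d j)] [∀ j : ℕ, Fact (0 < (L : ℝ) ^ j)] [∀ j : ℕ, Fact (0 < L ^ (d * j))]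
    (hd : 2 ≤ d) (hLodd : Odd L) (hM : M = L ^ N)
    (hp : d / 2 + 1 ≤ p) (hMord : d / 2 + 1 ≤ Mord)
    (hB : AbkmWeightBounds L N Mord R n θbar lam μ δ₁ δ₀ A𝒫 𝒞
      (abkmWeightData L N Mord R θbar (schedDelta δ₀ δ₁ N) 𝒞))
    (hδ₀ : 0 < δ₀) (hδ₁ : 0 < δ₁) (hh : 0 < h) (hh0 : hZeroSq d R δ₀ δ₁ ≤ h ^ 2) (hA : 0 < A)
    {𝒦 : (Fin d → ℝ) → ℂ} {ρ : ℝ} (h𝒦 : ContDiff ℝ r₀ 𝒦)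
    (h𝒦b : ∀ k, k ≤ r₀ → ∀ z : Fin d → ℝ, ‖iteratedFDeriv ℝ k 𝒦 z‖ ≤ ρ * Real.exp ((∑ i, z i ^ 2) / 4))
    (hsmall : (Real.exp (1 / 4) + 2 * Real.exp (3 / 8)) *
      (ρ * Real.exp (fieldWt h (L : ℝ) d 0 / (L : ℝ) ^ 0)) * A ≤ 1 / 2)
    (x x' : HamSpace ℂ d (fieldWt h (L : ℝ) d 0) ((L : ℝ) ^ 0) (L ^ (d * 0)))
    (hx : ‖x‖ ≤ 1 / 16) (hx' : ‖x'‖ ≤ 1 / 16) :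
    activityNormLE (abkmNormParams L N Mord R p r₀ h θbar A (schedDelta δ₀ δ₁ N) 𝒞) 0
      (initAct (N := N) (Mord := Mord) (R := R) (p := p) (r₀ := r₀) (θbar := θbar) (A := A) (δ₀ := δ₀)
          (δ₁ := δ₁) (𝒞 := 𝒞) 𝒦 x -
        initAct (N := N) (Mord := Mord) (R := R) (p := p) (r₀ := r₀) (θbar := θbar) (A := A) (δ₀ := δ₀)
          (δ₁ := δ₁) (𝒞 := 𝒞) 𝒦 x')
      (16 * Real.exp (3 / 8) * (ρ * Real.exp (fieldWt h (L : ℝ) d 0 / (L : ℝ) ^ 0)) * A * ‖x - x'‖) := by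
  have hρ : 0 ≤ ρ := by
    have h0 := (norm_nonneg _).trans (h𝒦b 0 (Nat.zero_le _) 0)
    exact (mul_nonneg_iff_of_pos_right (Real.exp_pos _)).1 h0
  have hsmall1 : Real.exp (1 / 4) * (ρ * Real.exp (fieldWt h (L : ℝ) d 0 / (L : ℝ) ^ 0)) * A ≤ 1 := by
    have h2 : Real.exp (1 / 4) * (ρ * Real.exp (fieldWt h (L : ℝ) d 0 / (L : ℝ) ^ 0)) * A ≤
        (Real.exp (1 / 4) + 2 * Real.exp (3 / 8)) * (ρ * Real.exp (fieldWt h (L : ℝ) d 0 / (L : ℝ) ^ 0)) * A := by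
      have : Real.exp (1 / 4) ≤ Real.exp (1 / 4) + 2 * Real.exp (3 / 8) := by
        have := Real.exp_pos (3 / 8 : ℝ); linarith
      exact mul_le_mul_of_nonneg_right (mul_le_mul_of_nonneg_right this (mul_nonneg hρ (Real.exp_pos _).le)) hA.le
    linarith
  have hH : hamNorm (fieldWt h (L : ℝ) d 0) ((L : ℝ) ^ 0) (L ^ (d * 0)) (HamSpace.toHam x) ≤ 1 / 16 := by
    rwa [HamSpace.norm_def] at hx
  have hH' : hamNorm (fieldWt h (L : ℝ) d 0) ((L : ℝ) ^ 0) (L ^ (d * 0)) (HamSpace.toHam x') ≤ 1 / 16 := by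
    rwa [HamSpace.norm_def] at hx'
  have hmem := restrictConn_initKH_mem_activitySpace hd hLodd hM hp hMord hB hδ₀ hδ₁ hh hh0 hA h𝒦 h𝒦b
    (hH.trans (by norm_num)) hsmall1
  have hmem' := restrictConn_initKH_mem_activitySpace hd hLodd hM hp hMord hB hδ₀ hδ₁ hh hh0 hA h𝒦 h𝒦b
    (hH'.trans (by norm_num)) hsmall1
  unfold activityNormLE
  rw [Submodule.coe_sub, coe_initAct_of_mem hmem, coe_initAct_of_mem hmem', ← restrictConn_sub,
    HamSpace.norm_def, map_sub]
  exact weakNormLE_restrictConn_iff.2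
    (weakNormLE_initKH_sub hd hLodd hM hp hMord hB hδ₀ hδ₁ hh hh0 hA h𝒦 h𝒦b hH hH' hsmall)

/-- **The round trip for `y₀`**: `mulExt (y₀(ℋ)) = K̂_0(𝒦, ℋ)` on every set of sites, when `y₀(ℋ)`
is admissible — so the flow started from `(H_0, mulExt y₀)` is the flow of [ABKM19] (12.11).
[cite: AdamsBuchholzKoteckyMuller2019, Ch. 12.1 (12.11)] -/
theorem mulExt_initAct {h δ₀ δ₁ : ℝ} (hLodd : Odd L) (hM : M = L ^ N) {𝒦 : (Fin d → ℝ) → ℂ}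
    {x : HamSpace ℂ d (fieldWt h (L : ℝ) d 0) ((L : ℝ) ^ 0) (L ^ (d * 0))}
    (hmem : restrictConn (L ^ 0) (initKH 𝒦 (HamSpace.toHam x)) ∈
      activitySpace (abkmNormParams L N Mord R p r₀ h θbar A (schedDelta δ₀ δ₁ N) 𝒞) 0)
    (X : Finset (Fin d → ZMod M)) :
    mulExt ((initAct (N := N) (Mord := Mord) (R := R) (p := p) (r₀ := r₀) (θbar := θbar) (A := A) (δ₀ := δ₀)
        (δ₁ := δ₁) (𝒞 := 𝒞) 𝒦 x :
        activitySpace (abkmNormParams L N Mord R p r₀ h θbar A (schedDelta δ₀ δ₁ N) 𝒞) 0) :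
      Finset (Fin d → ZMod M) → ((Fin d → ZMod M) → ℝ) → ℂ) X = initKH 𝒦 (HamSpace.toHam x) X := by
  rw [coe_initAct_of_mem hmem]
  exact mulExt_restrictConn_initKH hLodd hM 𝒦 _ X

end Bundled

end Literature.MathematicalPhysics.StatisticalMechanics.GradientRG

end
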